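import Summits.ValiantsHypothesis.ValiantsHypothesis.Theorems.FreeSubtorusOrbitDimensionBoundStubPerSummandExchange

/-!
# `OrbitDimensionBound` (stmt-ValiantsHypothesis-16133), rung line `square_covering` — stub `stub_stableReduction`,
# infrastructure: the multi-summand Krull–Schmidt EXCHANGE with biorthogonal families (plan step I2a/I2b)

Fourth helper file toward stub 1 `stub_stableReduction` (plan HOME/lmr/NOTE-p4g12-16133-stableReduction-plan.md).
Determinant-free form of «pairwise non-isomorphic indecomposable summands are jointly a direct summand»:

* `isNilpotent_of_local_of_trace`, `exists_unit_term_of_local` — in the LOCAL endomorphism algebra of a pencil `N`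
  (every endomorphism pair is `μ + nilpotent`) the non-units are closed under finite sums (trace), so a sum equal to a
  unit has a unit term;
* `iso_of_retract_of_local` — a retract of a local pencil by a non-zero pencil is an isomorphism;
* **`exists_biorthogonal_extension`** — given a BIORTHOGONAL family of retracts `(N_i, v^{(i)}, u^{(i)})_{i<s}` of `M`
  (`u^{(i)} v^{(j)} = δ_{ij}`, all of the same size `k₀ ≥ 1`), and a further LOCAL retract `(N_s, v, u)` of `M` (only
  `u_W v_W = 1` is used) NOT isomorphic to any `N_i`, the retract maps of `N_s` can be re-chosen (`w = (1 - e) v`,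
  `z = c⁻¹ u (1 - e)`, `e = Σ v^{(i)} u^{(i)}`, `c = u (1 - e) v` invertible by locality: otherwise some
  `t_i = (u v^{(i)})(u^{(i)} v)` is a unit of `End N_s` by the trace lemma and `N_s ≅ N_i`) so that the extended
  family is biorthogonal;
* `card_mul_le_of_biorthogonal` — a biorthogonal family of `t` retracts of size `k₀` forces `t · k₀ ≤ m`.

Helper mode (`--supports stmt-ValiantsHypothesis-16133 --as helper`).  Honest framing: infrastructure toward ONE
registered stub of a dormant rung line whose core `stub_gradedPowerCount` is OPEN; `OrbitDimensionBound`,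
`FreeSubtorus` and VP ≠ VNP are OPEN and not moved.

## References
* N. Jacobson, *Basic Algebra II*, 2nd ed. (1989), §3.4 (Krull–Schmidt) — orientation only.
-/

set_option linter.dupNamespace false

namespace Summit.ValiantsHypothesis.ValiantsHypothesis.Theorems.FreeSubtorusOrbitDimensionBound.SquareCovering

open Matrix MvPolynomial Finset Module.End
open Literature.Computability.AlgebraicComplexity
open Summit.ValiantsHypothesis.ValiantsHypothesis.Theorems.FreeSubtorusOrbitDimensionBound.SignCovering.PerSummand

section Local

variable {σ : Type*} {k : ℕ}

/-- Entrywise constant embedding of a finite sum of scalar matrices. -/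
theorem map_C_sum {ι p q : Type*} [Fintype ι] (f : ι → Matrix p q ℂ) :
    (∑ i, f i).map (C (σ := σ)) = ∑ i, (f i).map (C (σ := σ)) := by
  ext a b
  simp only [Matrix.map_apply, Matrix.sum_apply, map_sum]

/-- In a local endomorphism algebra an element of trace `0`... precisely: if every endomorphism pair of `N` is
`μ + nilpotent` and `(x_W, x_V)` is an endomorphism pair with `trace x_W = 0`, then `x_W` and `x_V` are nilpotent
(`k ≥ 1`). [folklore] -/
theorem isNilpotent_of_local_of_trace (N : Matrix (Fin k) (Fin k) (MvPolynomial σ ℂ)) (hk : 0 < k)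
    (hloc : ∀ g h : Matrix (Fin k) (Fin k) ℂ, g.map C * N = N * h.map C →
      ∃ μ : ℂ, IsNilpotent (g - μ • (1 : Matrix (Fin k) (Fin k) ℂ)) ∧ IsNilpotent (h - μ • (1 : Matrix (Fin k) (Fin k) ℂ)))
    (xW xV : Matrix (Fin k) (Fin k) ℂ) (hx : xW.map C * N = N * xV.map C) (htr : xW.trace = 0) :
    IsNilpotent xW ∧ IsNilpotent xV := by
  obtain ⟨μ, hW, hV⟩ := hloc xW xV hx
  have hμ : μ = 0 := by
    have h1 : (xW - μ • (1 : Matrix (Fin k) (Fin k) ℂ)).trace = 0 :=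
      (Matrix.isNilpotent_trace_of_isNilpotent hW).eq_zero
    rw [Matrix.trace_sub, Matrix.trace_smul, Matrix.trace_one, htr, Fintype.card_fin, smul_eq_mul, zero_sub,
      neg_eq_zero, mul_eq_zero] at h1
    rcases h1 with h1 | h1
    · exact h1
    · exact absurd (by exact_mod_cast h1 : k = 0) hk.ne'
  subst hμ
  rw [zero_smul, sub_zero] at hW hV
  exact ⟨hW, hV⟩

/-- **A sum that is a unit has a unit term** (local endomorphism algebra): if `Σ_i t_i = y` with all `(t_i)` and `y`
endomorphism pairs of the local pencil `N`, `k ≥ 1`, and `y_W` is NOT nilpotent, then some `t_i` is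
`μ_i + nilpotent` with `μ_i ≠ 0`. [folklore] -/
theorem exists_unit_term_of_local {s : ℕ} (N : Matrix (Fin k) (Fin k) (MvPolynomial σ ℂ)) (hk : 0 < k)
    (hloc : ∀ g h : Matrix (Fin k) (Fin k) ℂ, g.map C * N = N * h.map C →
      ∃ μ : ℂ, IsNilpotent (g - μ • (1 : Matrix (Fin k) (Fin k) ℂ)) ∧ IsNilpotent (h - μ • (1 : Matrix (Fin k) (Fin k) ℂ)))
    (tW tV : Fin s → Matrix (Fin k) (Fin k) ℂ) (ht : ∀ i, (tW i).map C * N = N * (tV i).map C)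
    (hy : ¬ IsNilpotent (∑ i, tW i)) :
    ∃ (i : Fin s) (μ : ℂ), μ ≠ 0 ∧ IsNilpotent (tW i - μ • (1 : Matrix (Fin k) (Fin k) ℂ)) ∧
      IsNilpotent (tV i - μ • (1 : Matrix (Fin k) (Fin k) ℂ)) := by
  classical
  by_contra hall
  push Not at hall
  -- every term is nilpotent (its `μ` must be `0`), hence has trace `0`
  have htr : ∀ i, (tW i).trace = 0 := by
    intro i
    obtain ⟨μ, hW, hV⟩ := hloc (tW i) (tV i) (ht i)
    by_cases hμ : μ = 0
    · subst hμ; rw [zero_smul, sub_zero] at hW; exact (Matrix.isNilpotent_trace_of_isNilpotent hW).eq_zero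
    · exact absurd hV (hall i μ hμ hW)
  -- the sum is an endomorphism pair of trace `0`, hence nilpotent
  have hsum : (∑ i, tW i).map (C (σ := σ)) * N = N * (∑ i, tV i).map (C (σ := σ)) := by
    rw [map_C_sum, map_C_sum, Matrix.sum_mul, Matrix.mul_sum]
    exact Finset.sum_congr rfl fun i _ => ht i
  have htr0 : (∑ i, tW i).trace = 0 := by rw [Matrix.trace_sum]; exact Finset.sum_eq_zero fun i _ => htr i
  exact hy (isNilpotent_of_local_of_trace N hk hloc _ _ hsum htr0).1

/-- **A retract of a local pencil by a non-zero pencil is an isomorphism.**  If `N'` is local, `k ≥ 1`, and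
`a : N → N'`, `a' : N' → N` are morphisms with `a' a = 1`, then also `a a' = 1`. [folklore] -/
theorem iso_of_retract_of_local {k' : ℕ} (N : Matrix (Fin k) (Fin k) (MvPolynomial σ ℂ))
    (N' : Matrix (Fin k') (Fin k') (MvPolynomial σ ℂ)) (hk : 0 < k)
    (hloc' : ∀ g h : Matrix (Fin k') (Fin k') ℂ, g.map C * N' = N' * h.map C →
      ∃ μ : ℂ, IsNilpotent (g - μ • (1 : Matrix (Fin k') (Fin k') ℂ)) ∧
        IsNilpotent (h - μ • (1 : Matrix (Fin k') (Fin k') ℂ)))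
    (aW aV : Matrix (Fin k') (Fin k) ℂ) (a'W a'V : Matrix (Fin k) (Fin k') ℂ)
    (ha : aW.map (C (σ := σ)) * N = N' * aV.map (C (σ := σ)))
    (ha' : a'W.map (C (σ := σ)) * N' = N * a'V.map (C (σ := σ)))
    (hW : a'W * aW = 1) (hV : a'V * aV = 1) : aW * a'W = 1 ∧ aV * a'V = 1 := by
  -- the idempotent `e' = a a'` of the local `N'`
  have he : (aW * a'W).map C * N' = N' * (aV * a'V).map C := hom_comp ha' ha
  have hidW : (aW * a'W) * (aW * a'W) = aW * a'W := by
    rw [Matrix.mul_assoc, ← Matrix.mul_assoc a'W, hW, Matrix.one_mul]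
  have hidV : (aV * a'V) * (aV * a'V) = aV * a'V := by
    rw [Matrix.mul_assoc, ← Matrix.mul_assoc a'V, hV, Matrix.one_mul]
  obtain ⟨μ, hμW, hμV⟩ := hloc' _ _ he
  by_cases hμ : μ = 0
  · -- `e'` nilpotent and idempotent ⇒ `e' = 0` ⇒ `1 = a' e' a = 0` on `N`, impossible for `k ≥ 1`
    exfalso
    subst hμ
    rw [zero_smul, sub_zero] at hμW
    have h0 : aW * a'W = 0 := IsIdempotentElem.eq_zero_of_isNilpotent hidW hμW
    have h1 : (1 : Matrix (Fin k) (Fin k) ℂ) = 0 := by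
      calc (1 : Matrix (Fin k) (Fin k) ℂ) = a'W * (aW * a'W) * aW := by
            rw [← Matrix.mul_assoc, hW, Matrix.one_mul, hW]
        _ = 0 := by rw [h0, Matrix.mul_zero, Matrix.zero_mul]
    have h2 := congrFun (congrFun h1 ⟨0, hk⟩) ⟨0, hk⟩
    simp at h2
  · -- `e'` invertible and idempotent ⇒ `e' = 1`
    have huW : IsUnit (aW * a'W) := isUnit_of_isNilpotent_sub_smul_one hμ hμW
    have huV : IsUnit (aV * a'V) := isUnit_of_isNilpotent_sub_smul_one hμ hμV
    refine ⟨?_, ?_⟩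
    · obtain ⟨u, hu⟩ := huW
      calc aW * a'W = (↑u⁻¹ * (u : Matrix (Fin k') (Fin k') ℂ)) * (aW * a'W) := by rw [Units.inv_mul, Matrix.one_mul]
        _ = ↑u⁻¹ * ((aW * a'W) * (aW * a'W)) := by rw [hu, Matrix.mul_assoc]
        _ = 1 := by rw [hidW, ← hu, Units.inv_mul]
    · obtain ⟨u, hu⟩ := huV
      calc aV * a'V = (↑u⁻¹ * (u : Matrix (Fin k') (Fin k') ℂ)) * (aV * a'V) := by rw [Units.inv_mul, Matrix.one_mul]
        _ = ↑u⁻¹ * ((aV * a'V) * (aV * a'V)) := by rw [hu, Matrix.mul_assoc]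
        _ = 1 := by rw [hidV, ← hu, Units.inv_mul]

end Local

section Biorthogonal

variable {σ : Type*} {m k₀ : ℕ}

/-- **Biorthogonal extension (the exchange step of the Krull–Schmidt theorem).**  See the module docstring.
[folklore] -/
theorem exists_biorthogonal_extension {s : ℕ} (M : Matrix (Fin m) (Fin m) (MvPolynomial σ ℂ))
    (N : Fin s → Matrix (Fin k₀) (Fin k₀) (MvPolynomial σ ℂ)) (Ns : Matrix (Fin k₀) (Fin k₀) (MvPolynomial σ ℂ))
    (hk₀ : 0 < k₀)
    (vW vV : Fin s → Matrix (Fin m) (Fin k₀) ℂ) (uW uV : Fin s → Matrix (Fin k₀) (Fin m) ℂ)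
    (hv : ∀ i, (vW i).map (C (σ := σ)) * N i = M * (vV i).map (C (σ := σ)))
    (hu : ∀ i, (uW i).map (C (σ := σ)) * M = N i * (uV i).map (C (σ := σ)))
    (hbiW : ∀ i j, uW i * vW j = if i = j then 1 else 0) (hbiV : ∀ i j, uV i * vV j = if i = j then 1 else 0)
    (v₀W v₀V : Matrix (Fin m) (Fin k₀) ℂ) (u₀W u₀V : Matrix (Fin k₀) (Fin m) ℂ)
    (hv₀ : v₀W.map (C (σ := σ)) * Ns = M * v₀V.map (C (σ := σ)))
    (hu₀ : u₀W.map (C (σ := σ)) * M = Ns * u₀V.map (C (σ := σ)))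
    (hu₀v₀W : u₀W * v₀W = 1)
    (hlocs : ∀ g h : Matrix (Fin k₀) (Fin k₀) ℂ, g.map C * Ns = Ns * h.map C →
      ∃ μ : ℂ, IsNilpotent (g - μ • (1 : Matrix (Fin k₀) (Fin k₀) ℂ)) ∧ IsNilpotent (h - μ • (1 : Matrix (Fin k₀) (Fin k₀) ℂ)))
    (hniso : ∀ i, ¬ ∃ (X Y X' Y' : Matrix (Fin k₀) (Fin k₀) ℂ),
      X.map (C (σ := σ)) * Ns = N i * Y.map (C (σ := σ)) ∧ X' * X = 1 ∧ Y' * Y = 1) :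
    ∃ (wW wV : Matrix (Fin m) (Fin k₀) ℂ) (zW zV : Matrix (Fin k₀) (Fin m) ℂ),
      wW.map (C (σ := σ)) * Ns = M * wV.map (C (σ := σ)) ∧ zW.map (C (σ := σ)) * M = Ns * zV.map (C (σ := σ)) ∧
      zW * wW = 1 ∧ zV * wV = 1 ∧ (∀ i, uW i * wW = 0) ∧ (∀ i, zW * vW i = 0) ∧
      (∀ i, uV i * wV = 0) ∧ (∀ i, zV * vV i = 0) := by
  classical
  -- the idempotent `e = Σ v^{(i)} u^{(i)}` of `M`
  set eW : Matrix (Fin m) (Fin m) ℂ := ∑ i, vW i * uW i with heW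
  set eV : Matrix (Fin m) (Fin m) ℂ := ∑ i, vV i * uV i with heV
  have he : eW.map (C (σ := σ)) * M = M * eV.map (C (σ := σ)) := by
    rw [heW, heV, map_C_sum, map_C_sum, Matrix.sum_mul, Matrix.mul_sum]
    exact Finset.sum_congr rfl fun i _ => hom_comp (hu i) (hv i)
  have hue : ∀ i, uW i * eW = uW i := by
    intro i
    rw [heW, Matrix.mul_sum, Finset.sum_eq_single i]
    · rw [← Matrix.mul_assoc, hbiW, if_pos rfl, Matrix.one_mul]
    · intro j _ hj; rw [← Matrix.mul_assoc, hbiW, if_neg (Ne.symm hj), Matrix.zero_mul]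
    · intro h; exact absurd (Finset.mem_univ i) h
  have hev : ∀ i, eW * vW i = vW i := by
    intro i
    rw [heW, Matrix.sum_mul, Finset.sum_eq_single i]
    · rw [Matrix.mul_assoc, hbiW, if_pos rfl, Matrix.mul_one]
    · intro j _ hj; rw [Matrix.mul_assoc, hbiW, if_neg hj, Matrix.mul_zero]
    · intro h; exact absurd (Finset.mem_univ i) h
  have hueV : ∀ i, uV i * eV = uV i := by
    intro i
    rw [heV, Matrix.mul_sum, Finset.sum_eq_single i]
    · rw [← Matrix.mul_assoc, hbiV, if_pos rfl, Matrix.one_mul]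
    · intro j _ hj; rw [← Matrix.mul_assoc, hbiV, if_neg (Ne.symm hj), Matrix.zero_mul]
    · intro h; exact absurd (Finset.mem_univ i) h
  have hevV : ∀ i, eV * vV i = vV i := by
    intro i
    rw [heV, Matrix.sum_mul, Finset.sum_eq_single i]
    · rw [Matrix.mul_assoc, hbiV, if_pos rfl, Matrix.mul_one]
    · intro j _ hj; rw [Matrix.mul_assoc, hbiV, if_neg hj, Matrix.mul_zero]
    · intro h; exact absurd (Finset.mem_univ i) h
  have hee : eW * eW = eW := by
    conv_lhs => rw [heW, Matrix.sum_mul]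
    rw [heW]; exact Finset.sum_congr rfl fun i _ => by rw [Matrix.mul_assoc, hue]
  have heeV : eV * eV = eV := by
    conv_lhs => rw [heV, Matrix.sum_mul]
    rw [heV]; exact Finset.sum_congr rfl fun i _ => by rw [Matrix.mul_assoc, hueV]
  have hr : ((1 : Matrix (Fin m) (Fin m) ℂ) - eW).map (C (σ := σ)) * M = M * ((1 : Matrix (Fin m) (Fin m) ℂ) - eV).map (C (σ := σ)) :=
    hom_sub (hom_one M) he
  have hrr : (1 - eW) * (1 - eW) = 1 - eW := by
    rw [Matrix.sub_mul, Matrix.one_mul, Matrix.mul_sub, Matrix.mul_one, hee, sub_self, sub_zero]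
  have hrrV : (1 - eV) * (1 - eV) = 1 - eV := by
    rw [Matrix.sub_mul, Matrix.one_mul, Matrix.mul_sub, Matrix.mul_one, heeV, sub_self, sub_zero]
  -- `c = u₀ (1 - e) v₀ ∈ End(N_s)` and the terms `t_i = (u₀ v^{(i)}) (u^{(i)} v₀)`
  set cW : Matrix (Fin k₀) (Fin k₀) ℂ := u₀W * ((1 - eW) * v₀W) with hcW
  set cV : Matrix (Fin k₀) (Fin k₀) ℂ := u₀V * ((1 - eV) * v₀V) with hcV
  have hc : cW.map (C (σ := σ)) * Ns = Ns * cV.map (C (σ := σ)) := hom_comp (hom_comp hv₀ hr) hu₀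
  set tW : Fin s → Matrix (Fin k₀) (Fin k₀) ℂ := fun i => (u₀W * vW i) * (uW i * v₀W) with htW
  set tV : Fin s → Matrix (Fin k₀) (Fin k₀) ℂ := fun i => (u₀V * vV i) * (uV i * v₀V) with htV
  have ht : ∀ i, (tW i).map (C (σ := σ)) * Ns = Ns * (tV i).map (C (σ := σ)) := fun i =>
    hom_comp (hom_comp hv₀ (hu i)) (hom_comp (hv i) hu₀)
  have hsumW : ∑ i, tW i = 1 - cW := by
    have : ∑ i, tW i = u₀W * eW * v₀W := by
      rw [heW, Matrix.mul_sum, Matrix.sum_mul]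
      exact Finset.sum_congr rfl fun i _ => by simp only [htW, Matrix.mul_assoc]
    rw [this, hcW, Matrix.sub_mul, Matrix.one_mul, Matrix.mul_sub, hu₀v₀W, sub_sub_cancel, Matrix.mul_assoc]
  obtain ⟨μ, hμW, hμV⟩ := hlocs cW cV hc
  by_cases hμ : μ = 0
  · -- `c` nilpotent: some term `t_i` is a unit, so `N_s ≅ N_i` — contradiction
    exfalso
    subst hμ
    rw [zero_smul, sub_zero] at hμW hμV
    have hy : ¬ IsNilpotent (∑ i, tW i) := by
      rw [hsumW]
      intro hnil
      have h1 : ((1 : Matrix (Fin k₀) (Fin k₀) ℂ) - cW).trace = 0 := (Matrix.isNilpotent_trace_of_isNilpotent hnil).eq_zero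
      rw [Matrix.trace_sub, Matrix.trace_one, (Matrix.isNilpotent_trace_of_isNilpotent hμW).eq_zero, sub_zero,
        Fintype.card_fin] at h1
      exact hk₀.ne' (by exact_mod_cast h1)
    obtain ⟨i, ν, hν, hνW, hνV⟩ := exists_unit_term_of_local Ns hk₀ hlocs tW tV ht hy
    obtain ⟨tWu, htWu⟩ := isUnit_of_isNilpotent_sub_smul_one hν hνW
    obtain ⟨tVu, htVu⟩ := isUnit_of_isNilpotent_sub_smul_one hν hνV
    -- `N_s → N_i → N_s` composes to the unit `t_i`: an isomorphism `N_s ≅ N_i` (same size), contradiction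
    have ha : (uW i * v₀W).map (C (σ := σ)) * Ns = N i * (uV i * v₀V).map (C (σ := σ)) := hom_comp hv₀ (hu i)
    have hretW : (↑tWu⁻¹ : Matrix (Fin k₀) (Fin k₀) ℂ) * (u₀W * vW i) * (uW i * v₀W) = 1 := by
      rw [Matrix.mul_assoc, show u₀W * vW i * (uW i * v₀W) = tW i from rfl, ← htWu, Units.inv_mul]
    have hretV : (↑tVu⁻¹ : Matrix (Fin k₀) (Fin k₀) ℂ) * (u₀V * vV i) * (uV i * v₀V) = 1 := by
      rw [Matrix.mul_assoc, show u₀V * vV i * (uV i * v₀V) = tV i from rfl, ← htVu, Units.inv_mul]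
    exact hniso i ⟨uW i * v₀W, uV i * v₀V, _, _, ha, hretW, hretV⟩
  · -- `c` invertible: re-choose the retract maps of `N_s`
    obtain ⟨cWu, hcWu⟩ := isUnit_of_isNilpotent_sub_smul_one hμ hμW
    obtain ⟨cVu, hcVu⟩ := isUnit_of_isNilpotent_sub_smul_one hμ hμV
    set cWi : Matrix (Fin k₀) (Fin k₀) ℂ := (↑cWu⁻¹ : Matrix (Fin k₀) (Fin k₀) ℂ) with hcWi
    set cVi : Matrix (Fin k₀) (Fin k₀) ℂ := (↑cVu⁻¹ : Matrix (Fin k₀) (Fin k₀) ℂ) with hcVi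
    have hcWicW : cWi * cW = 1 := by rw [hcWi, ← hcWu, Units.inv_mul]
    have hcVcVi : cV * cVi = 1 := by rw [hcVi, ← hcVu, Units.mul_inv]
    have hcinv : cWi.map (C (σ := σ)) * Ns = Ns * cVi.map (C (σ := σ)) := by
      calc cWi.map (C (σ := σ)) * Ns = cWi.map (C (σ := σ)) * Ns * (cV * cVi).map (C (σ := σ)) := by
            rw [hcVcVi, Matrix.map_one C C_0 C_1, Matrix.mul_one]
        _ = cWi.map (C (σ := σ)) * (cW.map (C (σ := σ)) * Ns) * cVi.map (C (σ := σ)) := by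
            rw [Matrix.map_mul, ← Matrix.mul_assoc, Matrix.mul_assoc (cWi.map C), ← hc]
        _ = Ns * cVi.map (C (σ := σ)) := by
            rw [← Matrix.mul_assoc, ← Matrix.map_mul, hcWicW, Matrix.map_one C C_0 C_1, Matrix.one_mul]
    refine ⟨(1 - eW) * v₀W, (1 - eV) * v₀V, cWi * (u₀W * (1 - eW)), cVi * (u₀V * (1 - eV)),
      hom_comp hv₀ hr, hom_comp (hom_comp hr hu₀) hcinv, ?_, ?_, fun i => ?_, fun i => ?_, fun i => ?_, fun i => ?_⟩
    · have : cWi * (u₀W * (1 - eW)) * ((1 - eW) * v₀W) = cWi * cW := by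
        rw [hcW]; simp only [Matrix.mul_assoc]; rw [← Matrix.mul_assoc (1 - eW), hrr]
      rw [this, hcWicW]
    · have hcVicV : cVi * cV = 1 := by rw [hcVi, ← hcVu, Units.inv_mul]
      have : cVi * (u₀V * (1 - eV)) * ((1 - eV) * v₀V) = cVi * cV := by
        rw [hcV]; simp only [Matrix.mul_assoc]; rw [← Matrix.mul_assoc (1 - eV), hrrV]
      rw [this, hcVicV]
    · rw [← Matrix.mul_assoc, Matrix.mul_sub, Matrix.mul_one, hue, sub_self, Matrix.zero_mul]
    · rw [Matrix.mul_assoc, Matrix.mul_assoc, Matrix.sub_mul, Matrix.one_mul, hev, sub_self, Matrix.mul_zero,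
        Matrix.mul_zero]
    · rw [← Matrix.mul_assoc, Matrix.mul_sub, Matrix.mul_one, hueV, sub_self, Matrix.zero_mul]
    · rw [Matrix.mul_assoc, Matrix.mul_assoc, Matrix.sub_mul, Matrix.one_mul, hevV, sub_self, Matrix.mul_zero,
        Matrix.mul_zero]

/-- **Biorthogonal families are short**: `t` retracts of size `k₀` with `u^{(i)} v^{(j)} = δ_{ij}` inside
`ℂ^m` force `t · k₀ ≤ m`. [folklore] -/
theorem card_mul_le_of_biorthogonal {t : ℕ} (vW : Fin t → Matrix (Fin m) (Fin k₀) ℂ)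
    (uW : Fin t → Matrix (Fin k₀) (Fin m) ℂ) (hbi : ∀ i j, uW i * vW j = if i = j then 1 else 0) :
    t * k₀ ≤ m := by
  classical
  -- the stacked maps `V : ℂ^{k₀ × t} → ℂ^m`, `U : ℂ^m → ℂ^{k₀ × t}` with `U V = 1`
  let V : Matrix (Fin m) (Fin k₀ × Fin t) ℂ := Matrix.of fun p q => vW q.2 p q.1
  let U : Matrix (Fin k₀ × Fin t) (Fin m) ℂ := Matrix.of fun q p => uW q.2 q.1 p
  have hUV : U * V = 1 := by
    ext a b
    rw [Matrix.mul_apply, Matrix.one_apply]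
    have h := congrFun (congrFun (hbi a.2 b.2) a.1) b.1
    rw [Matrix.mul_apply] at h
    simp only [V, U, Matrix.of_apply]
    rw [h]
    by_cases hab : a = b
    · subst hab; simp
    · by_cases h2 : a.2 = b.2
      · have h1 : a.1 ≠ b.1 := fun h1 => hab (Prod.ext h1 h2)
        rw [if_pos h2, Matrix.one_apply, if_neg h1, if_neg hab]
      · rw [if_neg h2, Matrix.zero_apply, if_neg hab]
  have hinj : Function.Injective (Matrix.toLin' V) := by
    intro x y hxy
    have := congrArg (Matrix.toLin' U) hxy
    rwa [← LinearMap.comp_apply, ← LinearMap.comp_apply, ← Matrix.toLin'_mul, hUV, Matrix.toLin'_one,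
      LinearMap.id_apply, LinearMap.id_apply] at this
  have h := LinearMap.finrank_le_finrank_of_injective hinj
  rw [Module.finrank_fin_fun, Module.finrank_pi, Fintype.card_prod, Fintype.card_fin, Fintype.card_fin] at h
  simpa [mul_comm] using h

end Biorthogonal

end Summit.ValiantsHypothesis.ValiantsHypothesis.Theorems.FreeSubtorusOrbitDimensionBound.SquareCovering
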